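import Summits.Ventures.CertifiedArithmetic.LowPrec.SRDyadicGridProducts
import HarnessLib

/-!
# The closed-form random-bit budgets are exact: every format attains `emaxCode − 1` and `+ (bias+m−1)`

HONEST FRAMING: certified error envelopes and provably optimal rounding/accumulation schemes for
low-precision formats under stated cost models; every table by two implementations; no hardware or
vendor claims.

File LXXXII of the SR slice.  LXXX proved, for every minifloat format, the UPPER bounds
`emaxCode − 1` random bits (summation trees of format data) and `(emaxCode − 1) + (bias + m − 1)`
(one-stage inner products) after which the IEEE P3109 `N`-bit stochastic-rounding rules reproduce
exact SR in law, and showed them attained for FP8 by kernel witnesses.  Here the LOWER bounds are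
proved for EVERY format at once, structurally, at the explicit state `−maxRat + δ` (top binade,
`0 < δ ≤ quantum`), whose exact up-probability is computed in closed form:

* `Format.maxScaled_eq`, `Format.shift_maxScaled_sub_one` — the top magnitude and its binade;
* **`pUp_valueSet_negMax_add`** — `pUp (valueSet φ) (−maxRat + δ) = δ / (2^(emaxCode−1) · quantum)`
  for `0 < δ ≤ quantum` (`emaxCode ≥ 2`, `topMan ≥ 1`);
* **`valueSet_tree_budget_sharp`** — with `δ = quantum` (the sum of the two format values `−maxRat`
  and `quantum`): the up-probability is `2^−(emaxCode−1)`, NOT an `(emaxCode − 2)`-bit dyadic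
  (`probAwayA (emaxCode−2) θ = 0`; as this state is NEGATIVE, where the rules act on the away
  probability `1 − θ`, rule `A` one bit short rounds UP with probability `2θ` and rules `B`, `C`
  never do — LXXXVIII/LXXXIX, erratum E1) — so the tree / pair budget `emaxCode − 1` of LXXX is
  EXACT for every such format;
* **`valueSet_ip_budget_sharp`** — with `δ = quantum²` (start `−maxRat` plus the exact product of the
  format values `quantum · quantum`): the up-probability is `2^−(emaxCode−1+j)`, not an
  `(emaxCode − 2 + j)`-bit dyadic — the one-stage inner-product budget of LXXX is EXACT;
* closed forms WITHOUT enumeration: `binary16_budgets_exact` (`29 / 53`), `bfloat16_budgets_exact`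
  (`253 / 386`), `binary32_budgets_exact` (`253 / 402`), and `fp8_budgets_exact` (E4M3 `14 / 23`, E5M2
  `29 / 45`, agreeing with the kernel witnesses of LXXX, which sit at the same states).

Reading (HONEST FRAMING): for the wide-exponent formats the statement "a few random bits reproduce
stochastic rounding" is false for whole computations in the strongest sense — the exact thresholds
ARE the exponent range (`253` bits for bfloat16/binary32 trees) — while the per-state dead band of
LXXVI explains what fewer bits do instead.
-/

namespace Literature.ComputerArithmetic.FloatingPoint

namespace Format

variable {φ : Format}

/-- The top magnitude in quanta: `maxScaled = (2^m + topMan) · 2^(emaxCode − 1)` (`emaxCode ≥ 1`). -/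
theorem maxScaled_eq (h : 1 ≤ φ.emaxCode) :
    φ.maxScaled = (2 ^ φ.manBits + φ.topMan) * 2 ^ (φ.emaxCode - 1) := by
  unfold maxScaled scaled; rw [if_neg (by omega)]

/-- The binade of the top cell: `shift (maxScaled − 1) = emaxCode − 1` when the top binade has an
interior point (`topMan ≥ 1`) and there are two normal binades (`emaxCode ≥ 2`). -/
theorem shift_maxScaled_sub_one (hE : 2 ≤ φ.emaxCode) (ht : 1 ≤ φ.topMan) :
    φ.shift (φ.maxScaled - 1) = φ.emaxCode - 1 := by
  apply le_antisymm (shift_le _)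
  by_contra hlt
  have h1 := lt_pow_shift (φ := φ) (n := φ.maxScaled - 1) (by omega)
  have h2 : 2 ^ (φ.manBits + 1 + φ.shift (φ.maxScaled - 1)) ≤ 2 ^ (φ.manBits + (φ.emaxCode - 1)) :=
    Nat.pow_le_pow_right (by norm_num) (by omega)
  have h3 : 2 ^ (φ.manBits + (φ.emaxCode - 1)) + 1 ≤ φ.maxScaled := by
    rw [maxScaled_eq (by omega), add_mul, ← pow_add]
    have : 1 ≤ φ.topMan * 2 ^ (φ.emaxCode - 1) :=
      le_trans ht (Nat.le_mul_of_pos_right _ (by positivity))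
    omega
  omega

end Format

namespace MiniFloat

variable {φ : Format}

/-- The least positive value `quantum` is a format value (as soon as the format has a nonzero value). -/
theorem quantum_mem_valueSet (h : 1 ≤ φ.maxScaled) : φ.quantum ∈ valueSet φ := by
  have hr : φ.Representable 1 :=
    representable_of_lt_pow (Nat.one_lt_two_pow (Nat.succ_ne_zero _)) h
  have hm := toRat_mem_valueSet (ofScaled φ false 1 h)
  rw [toRat_ofScaled h hr] at hm
  simpa using hm

end MiniFloat

end Literature.ComputerArithmetic.FloatingPoint

namespace Summit.Ventures.CertifiedArithmetic.LowPrec.SR.LimitedBits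

open Literature.ComputerArithmetic.P3109
open Literature.ComputerArithmetic.ConnollyHighamMary2021
open Literature.ComputerArithmetic.FloatingPoint (Format MiniFloat)
open Literature.ComputerArithmetic.FloatingPoint.MiniFloat (valueSet valueSet_nonempty)
open Summit.Ventures.CertifiedArithmetic.LowPrec.SR
open Finset STree

/-! ### The exact up-probability at the top cell -/

/-- **The top cell, in closed form.** For a format with `emaxCode ≥ 2` and `topMan ≥ 1` and any
`0 < δ ≤ quantum`, the exact-SR up-probability of `−maxRat + δ` over `valueSet φ` is
`δ / (2^(emaxCode − 1) · quantum)`: the candidates are `−maxRat` and `−maxRat + 2^(emaxCode−1)·quantum`. -/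
theorem pUp_valueSet_negMax_add (φ : Format) (hE : 2 ≤ φ.emaxCode) (ht : 1 ≤ φ.topMan) {δ : ℚ}
    (h0 : 0 < δ) (hδ : δ ≤ φ.quantum) :
    pUp (valueSet φ) (-φ.maxRat + δ) = δ / (2 ^ (φ.emaxCode - 1) * φ.quantum) := by
  set L := φ.emaxCode - 1 with hL
  have hq := φ.quantum_pos
  have hL1 : 1 ≤ L := by omega
  have h2L : (2 : ℚ) ≤ 2 ^ L := by
    calc (2 : ℚ) = 2 ^ 1 := by norm_num
      _ ≤ 2 ^ L := pow_le_pow_right₀ (by norm_num) hL1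
  have hms : φ.maxScaled = (2 ^ φ.manBits + φ.topMan) * 2 ^ L := Format.maxScaled_eq (by omega)
  have hA1 : (2 : ℚ) ≤ ((2 ^ φ.manBits + φ.topMan : ℕ) : ℚ) := by
    have : 2 ≤ 2 ^ φ.manBits + φ.topMan := by have := Nat.one_le_two_pow (n := φ.manBits); omega
    exact_mod_cast this
  set A : ℕ := 2 ^ φ.manBits + φ.topMan with hA
  have hmr : φ.maxRat = (A : ℚ) * 2 ^ L * φ.quantum := by
    unfold Format.maxRat; rw [hms]; push_cast; ring
  have h4 : (4 : ℚ) ≤ (A : ℚ) * 2 ^ L := by nlinarith [hA1, h2L]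
  have hc0 : -φ.maxRat + δ < 0 := by
    have : φ.quantum < (A : ℚ) * 2 ^ L * φ.quantum := by nlinarith [h4, hq]
    rw [hmr]; linarith
  have hca : |-φ.maxRat + δ| = φ.maxRat - δ := by rw [abs_of_neg hc0]; ring
  have hcm : |-φ.maxRat + δ| ≤ φ.maxRat := by rw [hca]; linarith
  -- no clamping
  have hin : InHull (valueSet φ) (-φ.maxRat + δ) := (valueSet_inHull_iff φ _).mpr hcm
  unfold pUp; rw [clamp_eq_self hin]
  -- the scaled magnitude `r = maxScaled − δ/quantum`, its floor and its binade
  have hr : |-φ.maxRat + δ| / φ.quantum = (A : ℚ) * 2 ^ L - δ / φ.quantum := by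
    rw [hca, hmr]; field_simp
  have hdq0 : 0 < δ / φ.quantum := div_pos h0 hq
  have hdq1 : δ / φ.quantum ≤ 1 := (div_le_one hq).mpr hδ
  have hr0 : 0 ≤ |-φ.maxRat + δ| / φ.quantum := div_nonneg (abs_nonneg _) hq.le
  have hle : |-φ.maxRat + δ| / φ.quantum ≤ φ.maxScaled := by
    rw [hr, hms]; push_cast; linarith
  have hms1 : 1 ≤ φ.maxScaled := by
    have : 0 < A * 2 ^ L := by positivity
    rw [hms]; omega
  have hfl : ⌊|-φ.maxRat + δ| / φ.quantum⌋ = ((φ.maxScaled - 1 : ℕ) : ℤ) := by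
    rw [hr, Int.floor_eq_iff]
    have e : (((φ.maxScaled - 1 : ℕ) : ℤ) : ℚ) = (A : ℚ) * 2 ^ L - 1 := by
      have : ((φ.maxScaled - 1 : ℕ) : ℚ) = (φ.maxScaled : ℚ) - 1 := by
        rw [Nat.cast_sub hms1, Nat.cast_one]
      rw [Int.cast_natCast, this, hms]; push_cast; ring
    rw [e]; constructor <;> linarith
  have hfn : ⌊|-φ.maxRat + δ| / φ.quantum⌋.toNat = φ.maxScaled - 1 := by
    rw [hfl, Int.toNat_natCast]
  have hs : φ.shift ⌊|-φ.maxRat + δ| / φ.quantum⌋.toNat = L := by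
    rw [hfn]; exact Format.shift_maxScaled_sub_one hE ht
  -- the two candidates from the directed grid
  have hε0 : 0 < δ / φ.quantum / 2 ^ L := by positivity
  have hε1 : δ / φ.quantum / 2 ^ L < 1 := by
    rw [div_lt_one (by positivity)]; linarith
  have hceil : ⌈|-φ.maxRat + δ| / φ.quantum / 2 ^ L⌉ = (A : ℤ) := by
    rw [hr, Int.ceil_eq_iff]; push_cast
    constructor
    · have : ((A : ℚ) * 2 ^ L - δ / φ.quantum) / 2 ^ L = A - δ / φ.quantum / 2 ^ L := by
        field_simp
      rw [this]; linarith
    · rw [div_le_iff₀ (by positivity)]; nlinarith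
  have hfloor : ⌊|-φ.maxRat + δ| / φ.quantum / 2 ^ L⌋ = (A : ℤ) - 1 := by
    rw [hr, Int.floor_eq_iff]; push_cast
    have e : ((A : ℚ) * 2 ^ L - δ / φ.quantum) / 2 ^ L = A - δ / φ.quantum / 2 ^ L := by
      field_simp
    rw [e]; constructor <;> linarith
  unfold probUp
  rw [MiniFloat.chm_roundDown_eq hcm, MiniFloat.chm_roundUp_eq hcm, MiniFloat.toRat_roundDown,
    MiniFloat.toRat_roundUp, if_pos hc0, if_pos hc0, Format.rdGrid_cast hr0 hle,
    Format.ruGrid_cast hr0 hle, hs, hceil, hfloor, hmr]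
  push_cast
  field_simp
  ring

/-! ### The tree budget `emaxCode − 1` is exact -/

/-- `1/2^M` is an `M`-bit dyadic and not an `N`-bit dyadic for `N < M`. -/
theorem dyadic_one_div_two_pow_iff {N M : ℕ} : Dyadic N ((1 : ℚ) / 2 ^ M) ↔ M ≤ N := by
  constructor
  · rintro ⟨m, hm⟩
    by_contra hlt
    have h1 : (0 : ℚ) < m := by rw [hm]; positivity
    have h2 : (m : ℚ) < 1 := by
      rw [hm, div_mul_eq_mul_div, one_mul, div_lt_one (by positivity)]
      exact pow_lt_pow_right₀ (by norm_num) (by omega)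
    have h1' : (0 : ℤ) < m := by exact_mod_cast h1
    have h2' : m < (1 : ℤ) := by exact_mod_cast h2
    omega
  · intro h
    refine ⟨2 ^ (N - M), ?_⟩
    push_cast
    rw [div_mul_eq_mul_div, one_mul, eq_div_iff (by positivity), ← pow_add, Nat.sub_add_cancel h]

/-- **The tree / pair budget `emaxCode − 1` is attained by every format** (`emaxCode ≥ 2`,
`topMan ≥ 1`): the two format values `−maxRat` and `quantum` sum to a state whose exact
up-probability `2^−(emaxCode−1)` is an `(emaxCode−1)`-bit but not an `(emaxCode−2)`-bit dyadic, and
`probAwayA (emaxCode−2)` vanishes at it — which at this NEGATIVE state means (erratum E1, files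
LXXXVIII/LXXXIX `valueSet_pair_one_bit_short`) that rule `A` with `emaxCode − 2` bits rounds up with
probability `2·2^−(emaxCode−1)`, twice the exact-SR probability, while rules `B`, `C` never do:
one bit below the budget of LXXX the law is already wrong under every rule. -/
theorem valueSet_tree_budget_sharp (φ : Format) (hE : 2 ≤ φ.emaxCode) (ht : 1 ≤ φ.topMan) :
    (-φ.maxRat ∈ valueSet φ ∧ φ.quantum ∈ valueSet φ) ∧
    pUp (valueSet φ) (-φ.maxRat + φ.quantum) = 1 / 2 ^ (φ.emaxCode - 1) ∧
    ¬ Dyadic (φ.emaxCode - 2) (pUp (valueSet φ) (-φ.maxRat + φ.quantum)) ∧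
    Dyadic (φ.emaxCode - 1) (pUp (valueSet φ) (-φ.maxRat + φ.quantum)) ∧
    probAwayA (φ.emaxCode - 2) (pUp (valueSet φ) (-φ.maxRat + φ.quantum)) = 0 := by
  have hq := φ.quantum_pos
  have hms1 : 1 ≤ φ.maxScaled := by
    have : 0 < (2 ^ φ.manBits + φ.topMan) * 2 ^ (φ.emaxCode - 1) := by positivity
    rw [Format.maxScaled_eq (by omega)]; omega
  have hv : pUp (valueSet φ) (-φ.maxRat + φ.quantum) = 1 / 2 ^ (φ.emaxCode - 1) := by
    rw [pUp_valueSet_negMax_add φ hE ht hq le_rfl]; field_simp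
  refine ⟨⟨MiniFloat.neg_maxRat_mem_valueSet φ, MiniFloat.quantum_mem_valueSet hms1⟩, hv, ?_, ?_, ?_⟩
  · rw [hv, dyadic_one_div_two_pow_iff]; omega
  · rw [hv, dyadic_one_div_two_pow_iff]
  · rw [hv]
    apply probAwayA_eq_zero _ (by positivity)
    rw [div_lt_div_iff_of_pos_left one_pos (by positivity) (by positivity)]
    exact pow_lt_pow_right₀ (by norm_num) (by omega)

/-! ### The one-stage inner-product budget `(emaxCode − 1) + (bias + m − 1)` is exact -/

/-- **The one-stage inner-product budget is attained by every format** (`emaxCode ≥ 2`, `topMan ≥ 1`,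
`bias + m ≥ 1`, `j = bias + m − 1`): from the format start `−maxRat`, adding the exact product of
the format values `quantum · quantum` gives a state of exact up-probability `2^−(emaxCode−1+j)`, an
`(emaxCode−1+j)`-bit but not an `(emaxCode−2+j)`-bit dyadic; `probAwayA` one bit short vanishes
(at this negative state: rule `A` rounds up twice too often, `B`, `C` never — erratum E1, LXXXIX
`valueSet_ip1_one_bit_short`). -/
theorem valueSet_ip_budget_sharp (φ : Format) (hE : 2 ≤ φ.emaxCode) (ht : 1 ≤ φ.topMan)
    (h1 : 1 ≤ φ.bias + φ.manBits) :
    (-φ.maxRat ∈ valueSet φ ∧ φ.quantum ∈ valueSet φ) ∧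
    pUp (valueSet φ) (-φ.maxRat + φ.quantum * φ.quantum)
      = 1 / 2 ^ (φ.emaxCode - 1 + (φ.bias + φ.manBits - 1)) ∧
    ¬ Dyadic (φ.emaxCode - 2 + (φ.bias + φ.manBits - 1))
      (pUp (valueSet φ) (-φ.maxRat + φ.quantum * φ.quantum)) ∧
    Dyadic (φ.emaxCode - 1 + (φ.bias + φ.manBits - 1))
      (pUp (valueSet φ) (-φ.maxRat + φ.quantum * φ.quantum)) ∧
    probAwayA (φ.emaxCode - 2 + (φ.bias + φ.manBits - 1))
      (pUp (valueSet φ) (-φ.maxRat + φ.quantum * φ.quantum)) = 0 := by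
  have hq := φ.quantum_pos
  have hqj := Format.quantum_eq_inv_two_pow h1
  have hq1 : φ.quantum ≤ 1 := by
    rw [hqj, div_le_one (by positivity)]; exact one_le_pow₀ (by norm_num)
  have hms1 : 1 ≤ φ.maxScaled := by
    have : 0 < (2 ^ φ.manBits + φ.topMan) * 2 ^ (φ.emaxCode - 1) := by positivity
    rw [Format.maxScaled_eq (by omega)]; omega
  have hv : pUp (valueSet φ) (-φ.maxRat + φ.quantum * φ.quantum)
      = 1 / 2 ^ (φ.emaxCode - 1 + (φ.bias + φ.manBits - 1)) := by
    rw [pUp_valueSet_negMax_add φ hE ht (mul_pos hq hq) (by nlinarith), pow_add]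
    rw [hqj]; field_simp
  refine ⟨⟨MiniFloat.neg_maxRat_mem_valueSet φ, MiniFloat.quantum_mem_valueSet hms1⟩, hv, ?_, ?_, ?_⟩
  · rw [hv, dyadic_one_div_two_pow_iff]; omega
  · rw [hv, dyadic_one_div_two_pow_iff]
  · rw [hv]
    apply probAwayA_eq_zero _ (by positivity)
    rw [div_lt_div_iff_of_pos_left one_pos (by positivity) (by positivity)]
    exact pow_lt_pow_right₀ (by norm_num) (by omega)

/-! ### Closed forms, no enumeration -/

/-- **binary16: the budgets `29` (trees) and `53` (one-stage inner products) are exact.**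
`pUp(−65504 + 2⁻²⁴) = 2⁻²⁹` is not a `28`-bit dyadic; `pUp(−65504 + 2⁻⁴⁸) = 2⁻⁵³` is not a `52`-bit
dyadic (no kernel enumeration of the `63 488` values is involved). -/
theorem binary16_budgets_exact :
    pUp (valueSet Format.Binary16) (-Format.Binary16.maxRat + Format.Binary16.quantum) = 1 / 2 ^ 29 ∧
    ¬ Dyadic 28 (pUp (valueSet Format.Binary16) (-Format.Binary16.maxRat + Format.Binary16.quantum)) ∧
    pUp (valueSet Format.Binary16)
        (-Format.Binary16.maxRat + Format.Binary16.quantum * Format.Binary16.quantum) = 1 / 2 ^ 53 ∧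
    ¬ Dyadic 52 (pUp (valueSet Format.Binary16)
        (-Format.Binary16.maxRat + Format.Binary16.quantum * Format.Binary16.quantum)) := by
  obtain ⟨-, h1, h2, -, -⟩ := valueSet_tree_budget_sharp Format.Binary16 (by decide) (by decide)
  obtain ⟨-, h3, h4, -, -⟩ := valueSet_ip_budget_sharp Format.Binary16 (by decide) (by decide) (by decide)
  exact ⟨h1, h2, h3, h4⟩

set_option maxRecDepth 8192 in
/-- **bfloat16: the budgets `253` (trees) and `386` (one-stage inner products) are exact** —
`pUp(−maxRat + 2⁻¹³³) = 2⁻²⁵³`, `pUp(−maxRat + 2⁻²⁶⁶) = 2⁻³⁸⁶`. -/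
theorem bfloat16_budgets_exact :
    pUp (valueSet Format.BFloat16) (-Format.BFloat16.maxRat + Format.BFloat16.quantum) = 1 / 2 ^ 253 ∧
    ¬ Dyadic 252 (pUp (valueSet Format.BFloat16) (-Format.BFloat16.maxRat + Format.BFloat16.quantum)) ∧
    pUp (valueSet Format.BFloat16)
        (-Format.BFloat16.maxRat + Format.BFloat16.quantum * Format.BFloat16.quantum) = 1 / 2 ^ 386 ∧
    ¬ Dyadic 385 (pUp (valueSet Format.BFloat16)
        (-Format.BFloat16.maxRat + Format.BFloat16.quantum * Format.BFloat16.quantum)) := by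
  obtain ⟨-, h1, h2, -, -⟩ := valueSet_tree_budget_sharp Format.BFloat16 (by decide) (by decide)
  obtain ⟨-, h3, h4, -, -⟩ := valueSet_ip_budget_sharp Format.BFloat16 (by decide) (by decide) (by decide)
  exact ⟨h1, h2, h3, h4⟩

set_option maxRecDepth 8192 in
/-- **binary32: the budgets `253` (trees) and `402` (one-stage inner products) are exact** —
`pUp(−maxRat + 2⁻¹⁴⁹) = 2⁻²⁵³`, `pUp(−maxRat + 2⁻²⁹⁸) = 2⁻⁴⁰²`. -/
theorem binary32_budgets_exact :
    pUp (valueSet Format.Binary32) (-Format.Binary32.maxRat + Format.Binary32.quantum) = 1 / 2 ^ 253 ∧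
    ¬ Dyadic 252 (pUp (valueSet Format.Binary32) (-Format.Binary32.maxRat + Format.Binary32.quantum)) ∧
    pUp (valueSet Format.Binary32)
        (-Format.Binary32.maxRat + Format.Binary32.quantum * Format.Binary32.quantum) = 1 / 2 ^ 402 ∧
    ¬ Dyadic 401 (pUp (valueSet Format.Binary32)
        (-Format.Binary32.maxRat + Format.Binary32.quantum * Format.Binary32.quantum)) := by
  obtain ⟨-, h1, h2, -, -⟩ := valueSet_tree_budget_sharp Format.Binary32 (by decide) (by decide)
  obtain ⟨-, h3, h4, -, -⟩ := valueSet_ip_budget_sharp Format.Binary32 (by decide) (by decide) (by decide)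
  exact ⟨h1, h2, h3, h4⟩

/-- **FP8, structurally** (agreeing with the kernel witnesses of LXXX, which sit at the same states
`−448 + 2⁻⁹`, `−448 + 2⁻¹⁸`, `−57344 + 2⁻¹⁶`, `−57344 + 2⁻³²`): E4M3 `14 / 23`, E5M2 `29 / 45` exact. -/
theorem fp8_budgets_exact :
    (pUp (valueSet Format.E4M3) (-Format.E4M3.maxRat + Format.E4M3.quantum) = 1 / 2 ^ 14 ∧
      pUp (valueSet Format.E4M3) (-Format.E4M3.maxRat + Format.E4M3.quantum * Format.E4M3.quantum)
        = 1 / 2 ^ 23) ∧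
    (pUp (valueSet Format.E5M2) (-Format.E5M2.maxRat + Format.E5M2.quantum) = 1 / 2 ^ 29 ∧
      pUp (valueSet Format.E5M2) (-Format.E5M2.maxRat + Format.E5M2.quantum * Format.E5M2.quantum)
        = 1 / 2 ^ 45) := by
  obtain ⟨-, h1, -, -, -⟩ := valueSet_tree_budget_sharp Format.E4M3 (by decide) (by decide)
  obtain ⟨-, h2, -, -, -⟩ := valueSet_ip_budget_sharp Format.E4M3 (by decide) (by decide) (by decide)
  obtain ⟨-, h3, -, -, -⟩ := valueSet_tree_budget_sharp Format.E5M2 (by decide) (by decide)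
  obtain ⟨-, h4, -, -, -⟩ := valueSet_ip_budget_sharp Format.E5M2 (by decide) (by decide) (by decide)
  exact ⟨⟨h1, h2⟩, h3, h4⟩

/-- **The exact budgets, both directions, every format** (summary): under `emaxCode ≥ 2`,
`topMan ≥ 1` (and `bias + m ≥ 1` for inner products), `N`-bit rule-`A`/`B`/`C` summation trees of
format data are exact in law for EVERY tree iff-style: sufficient at `N ≥ emaxCode − 1` (LXXX) and
necessary in the sense that at `N = emaxCode − 2` some pair of format values is rounded with the wrong
law; likewise one-stage inner products at `(emaxCode − 1) + (bias + m − 1)`. -/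
theorem valueSet_budgets_exact (φ : Format) (hE : 2 ≤ φ.emaxCode) (ht : 1 ≤ φ.topMan)
    (h1 : 1 ≤ φ.bias + φ.manBits) :
    (∀ {N : ℕ}, φ.emaxCode - 1 ≤ N → ∀ T : STree ℚ, LeavesIn (valueSet φ) T → ∀ f : ℚ → ℚ,
      treeExpQ (valueSet φ) (probAwayA N) T f = treeExp (valueSet φ) T f) ∧
    (∃ a ∈ valueSet φ, ∃ b ∈ valueSet φ,
      probAwayA (φ.emaxCode - 2) (pUp (valueSet φ) (a + b)) ≠ pUp (valueSet φ) (a + b)) ∧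
    (∀ {N : ℕ}, φ.emaxCode - 1 + (φ.bias + φ.manBits - 1) ≤ N → ∀ {x y : ℕ → ℚ},
      (∀ k, x k ∈ valueSet φ) → (∀ k, y k ∈ valueSet φ) → ∀ {s : ℚ}, s ∈ valueSet φ →
      ∀ n (f : ℚ → ℚ), accExpQ (valueSet φ) (probAwayA N) (fun k => x k * y k) n f s
        = accExp (valueSet φ) (fun k => x k * y k) n f s) ∧
    (∃ s ∈ valueSet φ, ∃ a ∈ valueSet φ, ∃ b ∈ valueSet φ,
      probAwayA (φ.emaxCode - 2 + (φ.bias + φ.manBits - 1)) (pUp (valueSet φ) (s + a * b))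
        ≠ pUp (valueSet φ) (s + a * b)) := by
  obtain ⟨⟨hm, hqm⟩, hv, -, -, hA⟩ := valueSet_tree_budget_sharp φ hE ht
  obtain ⟨-, hv', -, -, hA'⟩ := valueSet_ip_budget_sharp φ hE ht h1
  refine ⟨fun hN T hT f => (valueSet_tree_exact φ hN T hT f).1, ⟨_, hm, _, hqm, ?_⟩,
    fun hN x y hx hy s hs n f => (valueSet_ip_exact φ h1 hN hx hy hs n f).1, ⟨_, hm, _, hqm, _, hqm, ?_⟩⟩
  · rw [hA, hv]; positivity
  · rw [hA', hv']; positivity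

end Summit.Ventures.CertifiedArithmetic.LowPrec.SR.LimitedBits
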